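import Summits.ResolutionOfSingularities.ResolutionOfSingularities.Theorems.LatencyCutKernels
import HarnessLib

/-!
# LatencyCutClasses — decomp-res node «LatencyCut» (lens-4 g22) refining the MaxContactCut asides 28054 / 32260;
tree file 3/5 of the node

Content VERBATIM from the decomp-res lens-4 g22 file `HOME/decomp-res-lens-4/g22/LatencyCut.lean` (sha256 6bd4fa7be8c896a2,
940 l, written directly against the tree on top of the landed g21 node «TameCut» = `Theorems/TameCutClasses`,
`TameCutKernels`,
`MaxContactCutTameCut`).  HOME = run/shared/lean/pub/decomp-res.  Critic: CRITIC-LEDGER row 137 CLEARED, landing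
order 2026-08-30T19:54:01Z.

Route-independent, cone-free: §50 THE LATENCY AXIS of a tower class — «absolute contact at SOME stage»
(`LatentContact`, finite contact
latency) vs «PERMANENTLY ABSOLUTELY CONTACT-FREE» (`ContactFreeTower`); `NoTowerLatent` / `NoTowerContactFree`,
EXACT `noTower_iff_g22`,
monotonicity, the latent beds DECIDED by contact (`noTowerLatent_of_contact`, `…_of_not_contact`,
`noTowerPerfect_latent_of_contactPerfect`),
the contact-free beds on g21's weight/residue axis (`noTowerTameSep_contactFree`, `noTowerContactFree_iff_beds`,
`noTowerContactFree_of_g21`).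
The port-conditional `noTowerPerfect_latent_of_ports` is in `MaxContactCutLatencyCut` (Theses cone).

[WRITER NOTE (decomp-res writer g7): namespace `…Theorems.HugValuationCut` as the whole lens-4 chain; split by the
critic's order into
`TameCutStage` (§48), `LatencyCutKernels` (§49 + §53), `LatencyCutClasses` (§50) + `LatencyCutCells` (§51 + the
§52 all-weights CLASSES; the
critic's single `LatencyCutClasses` exceeds the 400-line file limit, hence two files), all four route-independent
(OUTSIDE the Theses cone,
importing only the cone-free `TameCutKernels` instead of the lens's `MaxContactCutTameCut`), and
`MaxContactCutLatencyCut` (inside the cone: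
the §52 BY-NAME theorems + the two port-conditional theorems `noTowerPerfect_latent_of_ports` (§50) /
`latentPerfectOffLocus_of_ports` (§51),
whose binder `MaxContactCut.MarkedThreefoldResolution` is a route decl).  `section StageKernel` re-opened in
`LatencyCutKernels`; the global
`set_option linter.dupNamespace false` dropped; the lens's consistency restatement
`contactHugging_of_isAbsContactAt_root'` (≡ the landed
`TameCutKernels.contactHugging_of_isAbsContactAt_root`, dedup.landed) deleted; nothing else changed.]

(Sources: Giraud1975; EncinasVillamayor2000 Thm. 4.9; BravoGarciaEscamillaVillamayor2012 Lemma 4.6; EGAIV4 Thm.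
16.11.2; CossartPiltant2008 Prop. 4.2; BierstoneGrigorievMilmanWlodarczyk2011 Lemma 3.4; GortzWedhorn2020 Prop.
13.96; Liu2002 Thm. 8.1.19; Matsumura1987 Thm. 15.5, Thm. 30.5; CossartJannsenSaito2020; CossartPiltant2019;
Hironaka1964; Moh1987; Cutkosky2009 Thm. 5.1.)
-/

noncomputable section

open CategoryTheory AlgebraicGeometry IsLocalRing
open Literature.AlgebraicGeometry.Resolution
open Summit.ResolutionOfSingularities.ResolutionOfSingularities.Theorems
open WeakOrderReduction ForcedTowerClasses DivergentTowerClasses MonomialTowerClasses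
open HugDimensionClasses HugDimensionKernels SurfaceShadowClasses SurfaceShadowKernels
open ContactShadowClasses (NoTowerImperfect ContactShadow TowerObstructsAll ContactPerfect)
open ContactShadowKernels (noTowerImperfect_of_noTower noTowerImperfect_mono noTower_iff_columns)
open NearPointCut (SingularClass singularSurface_iff_noTower)
open AbsoluteContactClasses (IsAbsContactAt SepResidueAt AbsInv absInv_point hsPortSepResidue sepResidueAt_of_perfectField not_perfectField_of_not_sepResidueAt diffIdeal_restrict_le)

namespace Summit.ResolutionOfSingularities.ResolutionOfSingularities.Theorems.HugValuationCut

/-! ## §50 (g22 · NEW) THE LATENCY AXIS of a tower class — «absolute contact at SOME stage» (finite contact latency) vs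
«PERMANENTLY ABSOLUTELY CONTACT-FREE» (purely inseparable initial forms at every infinitely near point) — and its
EXACT, port-free calculus on every column of g21's weight/residue axis -/

/-- **FINITE CONTACT LATENCY** (NEW TYPED PREDICATE of the cut): at SOME stage `j` the weight-`n` datum has an ABSOLUTE
contact element at `x_j` (`Diff^{≤ n−1}_ℤ(I_{j,x_j}) ⊄ 𝔪_{x_j}²`; census proxy at an `𝔽_p`-point of a
hypersurface of order
`n`: the initial form `in_n f_j` is NOT a form in `p`-th powers of the parameters, i.e. some exponent is `≢ 0 mod p`). -/
def LatentContact (n : ℕ) (T : ForcedTower) : Prop :=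
  ∃ j, IsAbsContactAt (T.D j).ideal n (T.pt j)

/-- **PERMANENTLY (absolutely) CONTACT-FREE** (THE TYPED RESIDUAL PREDICATE): at EVERY stage `Diff^{≤
n−1}_ℤ(I_{j,x_j}) ⊆
𝔪_{x_j}²` — Hironaka's purely inseparable situation at every infinitely near point of the tower. -/
def ContactFreeTower (n : ℕ) (T : ForcedTower) : Prop :=
  ∀ j, ¬ IsAbsContactAt (T.D j).ideal n (T.pt j)

/-- pure logic. [folklore] -/
theorem contactFreeTower_iff_not_latent {n : ℕ} {T : ForcedTower} : ContactFreeTower n T ↔ ¬ LatentContact n T := by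
  simp only [ContactFreeTower, LatentContact, not_exists]

/-- pure logic. [folklore] -/
theorem not_contactFreeTower_iff_latent {n : ℕ} {T : ForcedTower} : ¬ ContactFreeTower n T ↔ LatentContact n T := by
  rw [contactFreeTower_iff_not_latent, not_not]

/-- two classes with equivalent predicates coincide. [folklore] -/
theorem noTower_congr {n : ℕ} {P Q : ForcedTower → Prop} (h : ∀ T, P T ↔ Q T) : NoTower n P ↔ NoTower n Q :=
  ⟨noTower_mono fun T hQ => (h T).mpr hQ, noTower_mono fun T hP => (h T).mp hP⟩

/-- two wild classes with equivalent predicates coincide. [folklore] -/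
theorem noTowerWild_congr {n : ℕ} {P Q : ForcedTower → Prop} (h : ∀ T, P T ↔ Q T) : NoTowerWild n P ↔ NoTowerWild n Q :=
  ⟨noTowerWild_mono fun T hQ => (h T).mpr hQ, noTowerWild_mono fun T hP => (h T).mp hP⟩

/-- two tame–inseparable classes with equivalent predicates coincide. [folklore] -/
theorem noTowerTameInsep_congr {n : ℕ} {P Q : ForcedTower → Prop} (h : ∀ T, P T ↔ Q T) :
    NoTowerTameInsep n P ↔ NoTowerTameInsep n Q :=
  ⟨noTowerTameInsep_mono fun T hQ => (h T).mpr hQ, noTowerTameInsep_mono fun T hP => (h T).mp hP⟩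

/-- EXACT bisection of a WILD class by any predicate (excluded middle). [folklore] -/
theorem noTowerWild_split {n : ℕ} (P Q : ForcedTower → Prop) :
    NoTowerWild n P ↔ NoTowerWild n (fun T => P T ∧ Q T) ∧ NoTowerWild n (fun T => P T ∧ ¬ Q T) := by
  refine ⟨fun h => ⟨noTowerWild_mono (fun _ h' => h'.1) h, noTowerWild_mono (fun _ h' => h'.1) h⟩, ?_⟩
  rintro ⟨h₁, h₂⟩ p hp hpn k _ _ T g hB hD hE hP
  by_cases hQ : Q T
  · exact h₁ p hp hpn k T g hB hD hE ⟨hP, hQ⟩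
  · exact h₂ p hp hpn k T g hB hD hE ⟨hP, hQ⟩

/-- EXACT bisection of a TAME–INSEPARABLE class by any predicate (excluded middle). [folklore] -/
theorem noTowerTameInsep_split {n : ℕ} (P Q : ForcedTower → Prop) :
    NoTowerTameInsep n P ↔
      NoTowerTameInsep n (fun T => P T ∧ Q T) ∧ NoTowerTameInsep n (fun T => P T ∧ ¬ Q T) := by
  refine ⟨fun h => ⟨noTowerTameInsep_mono (fun _ h' => h'.1) h, noTowerTameInsep_mono (fun _ h' => h'.1) h⟩, ?_⟩
  rintro ⟨h₁, h₂⟩ p hp hpn k _ _ T g hB hD hE hs hP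
  by_cases hQ : Q T
  · exact h₁ p hp hpn k T g hB hD hE hs ⟨hP, hQ⟩
  · exact h₂ p hp hpn k T g hB hD hE hs ⟨hP, hQ⟩

/-- **The LATENT column** of a tower class `P` at weight `n`: the towers of the class with finite contact latency. -/
def NoTowerLatent (n : ℕ) (P : ForcedTower → Prop) : Prop := NoTower n fun T => P T ∧ LatentContact n T

/-- **The CONTACT-FREE column** of a tower class `P` at weight `n` (THE RESIDUAL SIDE of the cut). -/
def NoTowerContactFree (n : ℕ) (P : ForcedTower → Prop) : Prop := NoTower n fun T => P T ∧ ContactFreeTower n T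

/-- **Kernel (PROVED, pure logic): EXACT `NoTower n P ⟺ Latent ∧ ContactFree`.** [folklore] -/
theorem noTower_iff_g22 {n : ℕ} (P : ForcedTower → Prop) : NoTower n P ↔ NoTowerLatent n P ∧ NoTowerContactFree n P := by
  rw [NoTowerLatent, NoTowerContactFree, noTower_split P (LatentContact n)]
  exact and_congr Iff.rfl (noTower_congr fun T => by rw [contactFreeTower_iff_not_latent])

/-- monotonicity. [folklore] -/
theorem noTowerLatent_mono {n : ℕ} {P Q : ForcedTower → Prop} (hPQ : ∀ T, Q T → P T) (h : NoTowerLatent n P) :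
    NoTowerLatent n Q :=
  noTower_mono (fun T hT => ⟨hPQ T hT.1, hT.2⟩) h

/-- monotonicity. [folklore] -/
theorem noTowerContactFree_mono {n : ℕ} {P Q : ForcedTower → Prop} (hPQ : ∀ T, Q T → P T) (h : NoTowerContactFree n P) :
    NoTowerContactFree n Q :=
  noTower_mono (fun T hT => ⟨hPQ T hT.1, hT.2⟩) h

/-- the two columns of a terminating class terminate. [folklore] -/
theorem noTowerLatent_of_noTower {n : ℕ} {P : ForcedTower → Prop} (h : NoTower n P) : NoTowerLatent n P :=
  ((noTower_iff_g22 P).mp h).1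

/-- the two columns of a terminating class terminate. [folklore] -/
theorem noTowerContactFree_of_noTower {n : ℕ} {P : ForcedTower → Prop} (h : NoTower n P) : NoTowerContactFree n P :=
  ((noTower_iff_g22 P).mp h).2

/-- **KERNEL (PROVED) · THE LAW OF THE CUT: THE LATENT COLUMN OF EVERY CLASS IS A CONTACT COLUMN** — it terminates as
soon as the contact leaf 31571 does at the weight; no port, every field, every weight `n ≥ 1`
(`contactHugging_of_isAbsContactAt_stage`). (Sources: Giraud1975; EncinasVillamayor2000, Thm. 4.9.) -/
theorem noTowerLatent_of_contact {n : ℕ} (hn : 1 ≤ n) {P : ForcedTower → Prop} (h : ContactHuggingTowersTerminate n) :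
    NoTowerLatent n P := by
  intro p hp k _ _ T g hB hD hE hP
  obtain ⟨N, rfl⟩ : ∃ N, n = N + 1 := ⟨n - 1, by omega⟩
  obtain ⟨j, hj⟩ := hP.2
  exact h p hp k T g hB hD hE (contactHugging_of_isAbsContactAt_stage T g hB hD j hj)

/-- **KERNEL (PROVED): a class DISJOINT from contact has EMPTY latent column** (hypothesis-free). [folklore] -/
theorem noTowerLatent_of_not_contact {n : ℕ} (hn : 1 ≤ n) {P : ForcedTower → Prop}
    (hP : ∀ T, P T → ¬ ContactHugging T) : NoTowerLatent n P := by
  intro p hp k _ _ T g hB hD hE hPT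
  obtain ⟨N, rfl⟩ : ∃ N, n = N + 1 := ⟨n - 1, by omega⟩
  obtain ⟨j, hj⟩ := hPT.2
  exact hP T hPT.1 (contactHugging_of_isAbsContactAt_stage T g hB hD j hj)

/-- **KERNEL (PROVED): over a PERFECT field the latent column of every class lies in the perfect column of 31571**
(`ContactPerfect n`, DECIDED-MOD-PORT in the tree by `contactPerfect_of_ports`). [folklore] -/
theorem noTowerPerfect_latent_of_contactPerfect {n : ℕ} (hn : 1 ≤ n) {P : ForcedTower → Prop} (h : ContactPerfect n) :
    NoTowerPerfect n fun T => P T ∧ LatentContact n T := by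
  intro p hp k _ _ _ T g hB hD hE hP
  obtain ⟨N, rfl⟩ : ∃ N, n = N + 1 := ⟨n - 1, by omega⟩
  obtain ⟨j, hj⟩ := hP.2
  exact h p hp k T g hB hD hE (contactHugging_of_isAbsContactAt_stage T g hB hD j hj)

/-- **KERNEL (PROVED): A PERMANENTLY CONTACT-FREE TOWER IS WILD OR HAS AN INSEPARABLE ROOT** — with `p ∤ n` and a
separable root residue field the root itself is a contact stage (g21 `isAbsContactAt_of_tame_sep`): the residual of the
cut lies INSIDE g21's located residual `wild ∪ tame–inseparable`. (Sources: EGAIV4, Thm. 16.11.2.) -/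
theorem dvd_or_not_sepResidueAt_of_contactFree {p : ℕ} (hp : p.Prime) {n : ℕ} {K : Type} [Field K]
    [CharP K p] (T : ForcedTower) (g : T.St 0 ⟶ Spec (.of K)) (hB : IsBase (T.St 0) g) (hD : IsDatum n (T.D 0))
    (hcf : ContactFreeTower n T) : p ∣ n ∨ ¬ SepResidueAt g (T.pt 0) := by
  by_contra h
  push Not at h
  obtain ⟨hpn, hsep⟩ := h
  refine hcf 0 (isAbsContactAt_of_tame_sep hp g hB (T.D 0).ideal (T.isClosed_pt 0) hsep ?_ hpn)
  exact le_antisymm (hD.2 (T.pt 0)) (by have h0 : ((T.D 0).mult : ℕ∞) ≤ _ := (T.isolated 0).1; rwa [hD.1] at h0)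

/-- **KERNEL (PROVED): A TAME PERMANENTLY CONTACT-FREE TOWER IS PERMANENTLY INSEPARABLE** — with `p ∤ n`, the residue
field of EVERY point `x_m` of the tower is inseparable over `k` (else `x_m` is a contact stage by the tame contact theorem
at stage `m`).  The typed residual on the tame bed: «`p ∤ n`, `κ(x_m)/k` inseparable for all `m`, no absolute contact
at any stage». (Sources: EGAIV4, Thm. 16.11.2.) -/
theorem not_sepResidueAt_stage_of_contactFree {p : ℕ} (hp : p.Prime) {n : ℕ} (hpn : ¬ p ∣ n) {K : Type} [Field K]
    [CharP K p] (T : ForcedTower) (g : T.St 0 ⟶ Spec (.of K)) (hB : IsBase (T.St 0) g) (hD : IsDatum n (T.D 0))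
    (hcf : ContactFreeTower n T) (m : ℕ) : ¬ SepResidueAt (toRoot T m ≫ g) (T.pt m) :=
  fun hsep => hcf m (isAbsContactAt_of_tame_sepStage hp hpn T g hB hD m hsep)

/-- **KERNEL (PROVED): the TAME–SEPARABLE bed of the contact-free column of every class is EMPTY**
(hypothesis-free). [folklore] -/
theorem noTowerTameSep_contactFree {n : ℕ} (P : ForcedTower → Prop) :
    NoTowerTameSep n fun T => P T ∧ ContactFreeTower n T := by
  intro p hp hpn k _ _ T g hB hD hE hsep hP
  rcases dvd_or_not_sepResidueAt_of_contactFree hp T g hB hD hP.2 with h | h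
  · exact hpn h
  · exact h hsep

/-- **Kernel (PROVED): EXACT location of the residual on g21's axis —
`ContactFree(P) ⟺ Wild ∧ ContactFree(P)  ∧  TameInsep ∧ ContactFree(P)`** (the tame–separable bed is
empty). [folklore] -/
theorem noTowerContactFree_iff_beds {n : ℕ} (P : ForcedTower → Prop) :
    NoTowerContactFree n P ↔ NoTowerWild n (fun T => P T ∧ ContactFreeTower n T) ∧
      NoTowerTameInsep n (fun T => P T ∧ ContactFreeTower n T) := by
  rw [NoTowerContactFree, noTower_iff_g21]
  exact ⟨fun h => ⟨h.1, h.2.2⟩, fun h => ⟨h.1, noTowerTameSep_contactFree P, h.2⟩⟩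

/-- **Kernel (PROVED): THE RESIDUAL OF THE CUT IS WEAKER THAN g21's** — the wild and the tame–inseparable columns of a
class together contain its contact-free column. [folklore] -/

theorem noTowerContactFree_of_g21 {n : ℕ} {P : ForcedTower → Prop} (hW : NoTowerWild n P)
    (hI : NoTowerTameInsep n P) : NoTowerContactFree n P :=
  (noTowerContactFree_iff_beds P).mpr
    ⟨noTowerWild_mono (fun _ h => h.1) hW, noTowerTameInsep_mono (fun _ h => h.1) hI⟩

end Summit.ResolutionOfSingularities.ResolutionOfSingularities.Theorems.HugValuationCut
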